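import Literature.AlgebraicGeometry.Resolution.NearPointRidgeDietel
import Literature.AlgebraicGeometry.Resolution.PermissibleBlowupHilbertSamuel
import Literature.RingTheory.KrullDimension.AffineDimension
import Mathlib.RingTheory.KrullDimension.NonZeroDivisors
import HarnessLib

/-!
# [OURS · L1 W4.2] The near-point alignment: CJS-nearness `H_{X'}(x') = H_X(x)` forces
# `tr.deg(κ(x')/κ(x)) = d`, `φ_{X'}(x') = φ_X(x) + d` and `H^{(d+1)}[𝒪_{X',x'}] = H^{(1)}[𝒪_{X,x}]`
# — object «NEAR-ALIGNMENT + DIETEL BRIDGES» of campaign s42 / chain w42 (crux `SigmaMaxModifications`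
# stmt-ResolutionOfSingularities-18506, conjunct stmt-19249), res-L1-w42-plan-1 RULINGS v3.10-3 (a), cell res-hironaka

HONEST FRAMING. OURS proof file (typed and proved by res-L1-type-o1), FACT-FREE: the equality case of the tree's
Cossart–Jannsen–Saito Thm. 3.10 (1) (`Literature/…/PermissibleBlowupHilbertSamuelLocal.lean`,
`PermissibleBlowupHilbertSamuel.lean` — Bennett–Hironaka–Singh along a permissible centre plus the `ψ`-bookkeeping
(3.7)–(3.9)), made explicit as the conversion that every consumer of Dietel's Thm. (8.2.7) (ii) / Main Theorem C
(`NearPointRidgeDietel.lean`, F-54 / F-58 / F-58♭) from CJS-near data needs: those facts are stated under "(8.2.7.A)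
is an equality", `H^{(d+1)}_{X',x'} = H^{(1)}_{X,x}` with `d = tr.deg(κ(x')/κ(x))`, whereas the campaign's near points
(`CampaignW42.IsNearPoint`, the marked stages of line `w_ladder`) carry `Scheme.hsFun`-equality at a level `N`. Nothing
here is a statement of H. Hironaka's manuscript [Hironaka2017]; nothing about resolution of singularities is asserted;
published mathematics (CJS 2020, Matsumura Thm. 5.6) is USED through the tree, not restated. AI-produced; weaker than
expert review. Consumer: `HilbertSamuelEliminationCampaignW42RidgeDietel.lean` ((b1) `ridgeDimMonotone_of_dietel`).

## The argument (no hypothesis on the level `N`; every point of the fibre; every characteristic)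

Present `𝒪' = 𝒪_{X',x'}` as `C_𝔴` for the Rees chart `C = 𝒪[J/c_j]` over `𝒪 = 𝒪_{X,π x'}` and put **`d := dim C/𝔴`**
(the coheight of `𝔴` in `Spec C`): (i) a chain of primes of length `d` issues from `𝔴`, so the tree's sharp
Bennett–Singh inequality gives `H^{(i+d)}[𝒪'] ≤ H^{(i)}[𝒪]`; (ii) every chain from `𝔴` has length `≤ d`, so the
tree's (3.7)–(3.8) chain gives `ψ(𝒪) ≤ ψ(𝒪') + d`; (iii) SQUEEZE `H^{(a')}[𝒪'] ≤ H^{(a+d)}[𝒪'] ≤ H^{(a)}[𝒪] = H^{(a')}[𝒪']`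
(`a = N ∸ ψ(𝒪)`, `a' = N ∸ ψ(𝒪') ≤ a + d`), so `a' = a + d` by injectivity of `t ↦ H^{(t)}_A`, and stripping the
common summations yields `H^{(d+1)}[𝒪'] = H^{(1)}[𝒪]`; (iv) `dim C/𝔴 = tr.deg_k(C/𝔴) = tr.deg_k κ(𝔴)`
(`k = κ(π x')`; Matsumura Thm. 5.6 and the tower law over the algebraic extension `κ(𝔴) ⊇ C/𝔴`). The `κ(π x')`-algebra
structure on `κ(x')` is `residueAlgebraOfHom π x'` (the term F-54 / F-58 quantify over; W42Ridge's `residueAlgebra`).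

## Contents (namespace `…Theorems.CampaignW42`)

* (AL-1) `hilbertSamuelFun_apply_zero/one`, `eq_of_hilbertSamuelFun_eq` (injectivity of `t ↦ H^{(t)}_A`),
  `hilbertSamuelFun_squeeze`; (AL-2) `coheight_eq_of_ringKrullDim_quotient_eq`; (AL-3) generic algebra:
  `finiteType_residueField_quotient`, `trdeg_residueField_eq_of_isLocalization_atPrime`; (AL-4) on the chart:
  `minimalPrimesCodim_le_add_of_ringKrullDim_quotient_eq` (`ψ(𝒪) ≤ ψ(𝒪') + d`),
  `hilbertSamuelFun_add_le_of_ringKrullDim_quotient_eq` (`H^{(i+d)}[𝒪'] ≤ H^{(i)}[𝒪]`),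
  `hilbertSamuelFun_succ_eq_of_sub_minimalPrimesCodim_eq` (the alignment in the local rings),
  `exists_ringKrullDim_quotient_eq_and_trdeg_eq` (`d = tr.deg`);
* **(AL) `exists_trdeg_hilbertSamuelFun_eq_of_hsFun_eq`** — the scheme-level statement.

VACUITY. Not vacuous (every point of a blow-up of a regular scheme in a regular centre is CJS-near); sharp (`d` is
at once the residual transcendence degree, the jump of `φ`, and the index shift of the Hilbert–Samuel functions).

## References

* V. Cossart, U. Jannsen, S. Saito, LNM 2270 (2020), Def. 2.28, Thm. 3.10, (3.7)–(3.9), (3.14). [CossartJannsenSaito2020]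
* B. Dietel, Dissertation Regensburg (2014/2015), Thm. (8.2.7) p. 105 [Dietel2015]; H. Matsumura, *Commutative Ring
  Theory* (1986), Thm. 5.6 [Matsumura1987]; Herrmann–Ikeda–Orbanz (1988), Cor. (31.2) [HerrmannIkedaOrbanz1988].
-/

noncomputable section

set_option linter.dupNamespace false -- mandated namespace of this single-conjunct summit

open CategoryTheory AlgebraicGeometry TopologicalSpace IsLocalRing
open Literature.RingTheory.HilbertSamuel Literature.RingTheory.MvPolynomial
open Literature.AlgebraicGeometry.Resolution

namespace Summit.ResolutionOfSingularities.ResolutionOfSingularities.Theorems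

namespace CampaignW42

universe u

/-! ## (AL-1) Bookkeeping on Hilbert–Samuel functions: `t ↦ H^{(t)}_A` is injective; the squeeze -/

/-- (AL-1) `H^{(t)}_A(0) = H^{(0)}_A(0)` for every `t` (the partial sums at `0` keep the first value). OURS helper
(elementary bookkeeping on CJS's `H^{(t)}`); NOT a statement of the manuscript. [cite: CossartJannsenSaito2020, §2.2 (p. 27)] -/
theorem hilbertSamuelFun_apply_zero (A : Type u) [CommRing A] [IsLocalRing A] (t : ℕ) :
    hilbertSamuelFun A t 0 = hilbertFun A 0 := by
  induction t with
  | zero => rfl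
  | succ t ih => rw [hilbertSamuelFun_succ, psum_zero, ih]

/-- (AL-1) `H^{(t)}_A(1) = H^{(0)}_A(1) + t · H^{(0)}_A(0)`: each summation adds `H^{(0)}_A(0)` to the value at `1`.
OURS helper; NOT a statement of the manuscript. [cite: CossartJannsenSaito2020, §2.2 (p. 27)] -/
theorem hilbertSamuelFun_apply_one (A : Type u) [CommRing A] [IsLocalRing A] (t : ℕ) :
    hilbertSamuelFun A t 1 = hilbertFun A 1 + t * hilbertFun A 0 := by
  induction t with
  | zero => rw [hilbertSamuelFun_zero, zero_mul, add_zero]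
  | succ t ih =>
    rw [hilbertSamuelFun_succ, psum_apply, Finset.sum_range_succ, Finset.sum_range_one,
      hilbertSamuelFun_apply_zero, ih]
    ring

/-- (AL-1) **`t ↦ H^{(t)}_A` is injective** for a noetherian local ring `A`: `H^{(t)}_A(1) = emb.dim A + t` since
`H^{(0)}_A(0) = dim_k A/𝔪 = 1`. OURS helper; NOT a statement of the manuscript.
[cite: CossartJannsenSaito2020, §2.2 (p. 27)] -/
theorem eq_of_hilbertSamuelFun_eq (A : Type u) [CommRing A] [IsLocalRing A] [IsNoetherianRing A]
    {s t : ℕ} (h : hilbertSamuelFun A s = hilbertSamuelFun A t) : s = t := by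
  have h1 := congrFun h 1
  rw [hilbertSamuelFun_apply_one, hilbertSamuelFun_apply_one, hilbertFun_zero] at h1
  omega

/-- (AL-1) **The squeeze.** For local rings `𝒪`, `𝒪'` (`𝒪'` noetherian) and `a' ≤ a + ℓ`: if
`H^{(i+ℓ)}[𝒪'] ≤ H^{(i)}[𝒪]` for all `i` (Bennett–Singh along a chain of length `ℓ`) and `H^{(a')}[𝒪'] = H^{(a)}[𝒪]`
(nearness at some level), then `a' = a + ℓ` AND `H^{(ℓ+1)}[𝒪'] = H^{(1)}[𝒪]`: the chain
`H^{(a')}[𝒪'] ≤ H^{(a+ℓ)}[𝒪'] ≤ H^{(a)}[𝒪] = H^{(a')}[𝒪']` collapses, injectivity of `t ↦ H^{(t)}[𝒪']` gives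
`a' = a + ℓ`, and the common `a ∸ 1` summations are stripped (`iterPSum_injective`; one summation applied if `a = 0`).
OURS helper (the arithmetic of CJS (3.9) in the equality case); NOT a statement of the manuscript.
[cite: CossartJannsenSaito2020, Thm. 3.10 (proof, (3.9))] -/
theorem hilbertSamuelFun_squeeze {O O' : Type u} [CommRing O] [IsLocalRing O] [CommRing O']
    [IsLocalRing O'] [IsNoetherianRing O'] {a a' l : ℕ} (hle : a' ≤ a + l)
    (hS : ∀ i, hilbertSamuelFun O' (i + l) ≤ hilbertSamuelFun O i)
    (heq : hilbertSamuelFun O' a' = hilbertSamuelFun O a) :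
    a' = a + l ∧ hilbertSamuelFun O' (l + 1) = hilbertSamuelFun O 1 := by
  have h1 : hilbertSamuelFun O' a' ≤ hilbertSamuelFun O' (a + l) := hilbertSamuelFun_mono hle
  have h2 : hilbertSamuelFun O' (a + l) ≤ hilbertSamuelFun O' a' := by
    rw [heq]; exact hS a
  have h3 : a' = a + l := eq_of_hilbertSamuelFun_eq O' (le_antisymm h1 h2)
  refine ⟨h3, ?_⟩
  subst h3
  cases a with
  | zero =>
    rw [zero_add] at heq
    rw [hilbertSamuelFun_succ, hilbertSamuelFun_succ, heq]
  | succ a =>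
    rw [show a + 1 + l = a + (l + 1) by omega, ← iterPSum_hilbertSamuelFun,
      ← iterPSum_hilbertSamuelFun] at heq
    exact iterPSum_injective a heq

/-! ## (AL-2) Chains of primes above `P` and `dim C/P` -/

/-- (AL-2) **`coheight(P) = dim R/P`** in `Spec R`: the primes above `P` are the primes of `R/P` (Mathlib
`ringKrullDim_quotient`, `Order.coheight_eq_krullDim_Ici`). OURS helper; NOT a statement of the manuscript. [folklore] -/
theorem coheight_eq_of_ringKrullDim_quotient_eq {R : Type u} [CommRing R] (P : Ideal R) [P.IsPrime]
    {d : ℕ} (hd : ringKrullDim (R ⧸ P) = d) :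
    Order.coheight (⟨P, inferInstance⟩ : PrimeSpectrum R) = d := by
  have h1 : ((Order.coheight (⟨P, inferInstance⟩ : PrimeSpectrum R) : ℕ∞) : WithBot ℕ∞) =
      ringKrullDim (R ⧸ P) := by
    rw [Order.coheight_eq_krullDim_Ici, ringKrullDim_quotient]
    refine Order.krullDim_eq_of_orderIso (OrderIso.setCongr _ _ ?_)
    ext q
    rw [Set.mem_Ici, PrimeSpectrum.mem_zeroLocus, SetLike.coe_subset_coe]
    exact (PrimeSpectrum.asIdeal_le_asIdeal _ _).symm
  rw [hd] at h1
  exact_mod_cast h1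


/-! ## (AL-3) Generic algebra: residue fields of localizations at a prime -/

/-- (AL-3) For an algebra `C` of finite type over a local ring `(𝒪, 𝔫, k)` and an ideal `P ⊆ C`, a `k`-algebra
structure on `C/P` compatible with `𝒪 → C → C/P` makes `C/P` of finite type over `k`. OURS helper; NOT a statement of
the manuscript. [folklore] -/
theorem finiteType_residueField_quotient {O C : Type u} [CommRing O] [IsLocalRing O] [CommRing C]
    [Algebra O C] [Algebra.FiniteType O C] (P : Ideal C) [Algebra (ResidueField O) (C ⧸ P)]
    (h : ∀ r : O, algebraMap (ResidueField O) (C ⧸ P) (residue O r) =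
      Ideal.Quotient.mk P (algebraMap O C r)) :
    Algebra.FiniteType (ResidueField O) (C ⧸ P) := by
  haveI : IsScalarTower O (ResidueField O) (C ⧸ P) :=
    IsScalarTower.of_algebraMap_eq fun r => by
      rw [← Ideal.Quotient.mk_algebraMap, ← h]; rfl
  exact Algebra.FiniteType.of_restrictScalars_finiteType O (ResidueField O) (C ⧸ P)

/-- (AL-3) **`tr.deg_k κ(P) = tr.deg_k (C/P)`**: for a prime `P` of `C`, a localization `𝒪' = C_P` and a field `k`
acting compatibly on `C/P` and on the residue field `κ(P) = 𝒪'/P𝒪'`, the residue field is ALGEBRAIC over the domain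
`C/P` (every element is a fraction `a/s`, `s ∉ P`), `C/P → κ(P)` is injective, and the tower law
`tr.deg_k κ(P) = tr.deg_k(C/P) + tr.deg_{C/P} κ(P)` (Mathlib `trdeg_add_eq`, `trdeg_eq_zero`) concludes. OURS helper;
NOT a statement of the manuscript. [cite: Matsumura1987, Thm 5.6] -/
theorem trdeg_residueField_eq_of_isLocalization_atPrime {k C O' : Type u} [Field k] [CommRing C]
    (P : Ideal C) [P.IsPrime] [CommRing O'] [Algebra C O'] [IsLocalization.AtPrime O' P]
    [IsLocalRing O'] [Algebra k (C ⧸ P)] [Algebra k (ResidueField O')]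
    [Algebra (C ⧸ P) (ResidueField O')] [IsScalarTower k (C ⧸ P) (ResidueField O')]
    (h : ∀ a : C, algebraMap (C ⧸ P) (ResidueField O') (Ideal.Quotient.mk P a) =
      residue O' (algebraMap C O' a)) :
    Algebra.trdeg k (ResidueField O') = Algebra.trdeg k (C ⧸ P) := by
  haveI : IsDomain (C ⧸ P) := Ideal.Quotient.isDomain P
  haveI : FaithfulSMul k (C ⧸ P) :=
    (faithfulSMul_iff_algebraMap_injective k (C ⧸ P)).2 (algebraMap k (C ⧸ P)).injective
  haveI : FaithfulSMul (C ⧸ P) (ResidueField O') := by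
    refine (faithfulSMul_iff_algebraMap_injective (C ⧸ P) (ResidueField O')).2 ?_
    rw [injective_iff_map_eq_zero]
    intro a ha
    obtain ⟨a, rfl⟩ := Ideal.Quotient.mk_surjective a
    rw [h, residue_eq_zero_iff, IsLocalization.AtPrime.to_map_mem_maximal_iff O' P a] at ha
    exact Ideal.Quotient.eq_zero_iff_mem.mpr ha
  haveI : Algebra.IsAlgebraic (C ⧸ P) (ResidueField O') := by
    refine ⟨fun z => ?_⟩
    obtain ⟨o, rfl⟩ := IsLocalRing.residue_surjective z
    obtain ⟨⟨a, s⟩, hs⟩ := IsLocalization.surj P.primeCompl o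
    have hs0 : Ideal.Quotient.mk P (s : C) ≠ 0 := fun h0 =>
      s.2 (Ideal.Quotient.eq_zero_iff_mem.mp h0)
    refine ⟨Polynomial.C (Ideal.Quotient.mk P (s : C)) * Polynomial.X -
      Polynomial.C (Ideal.Quotient.mk P a), ?_, ?_⟩
    · intro h0
      have h1 := congrArg (fun q : Polynomial (C ⧸ P) => q.coeff 1) h0
      simp only [Polynomial.coeff_sub, Polynomial.coeff_C_mul, Polynomial.coeff_X_one, mul_one,
        Polynomial.coeff_C, one_ne_zero, if_false, sub_zero, Polynomial.coeff_zero] at h1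
      exact hs0 h1
    · rw [map_sub, map_mul, Polynomial.aeval_C, Polynomial.aeval_X, Polynomial.aeval_C, h, h,
        ← map_mul, ← map_sub, residue_eq_zero_iff]
      have h' : algebraMap C O' (s : C) * o - algebraMap C O' a = 0 := by
        rw [mul_comm, hs, sub_self]
      rw [h']
      exact zero_mem _
  have hadd := trdeg_add_eq k (C ⧸ P) (A := ResidueField O')
  rw [trdeg_eq_zero (R := C ⧸ P) (A := ResidueField O'), add_zero] at hadd
  exact hadd.symm

/-! ## (AL-4) The chart of a permissible blow-up: equality case of CJS Thm. 3.10 (1) -/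

section Chart

variable {O : Type u} [CommRing O] [IsLocalRing O] [IsNoetherianRing O] {n : ℕ} (c : Fin n → O)
  (j : Fin n) (P : Ideal (chartRing c j)) [P.IsPrime]
  (O' : Type u) [CommRing O'] [Algebra (chartRing c j) O'] [IsLocalization.AtPrime O' P]
  [IsLocalRing O'] [Algebra O O']

omit [Algebra O O'] in
/-- (AL-4) **`ψ(𝒪) ≤ ψ(𝒪') + dim C/𝔴`** on the chart `C = 𝒪[𝔭/c_j]` of a blow-up of a universally catenary
noetherian local ring `𝒪`, `𝒪' = C_𝔴`, `𝔴 ∩ 𝒪 = 𝔫`: the tree's (3.7)–(3.8) chain from `𝔴`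
(`exists_ltSeries_minimalPrimesCodim_le`) has length at most the coheight `dim C/𝔴` of `𝔴`. OURS helper (CJS
(3.7)–(3.8) with the chain length named); NOT a statement of the manuscript.
[cite: CossartJannsenSaito2020, Thm. 3.10 (1) (proof, (3.7)–(3.8))] -/
theorem minimalPrimesCodim_le_add_of_ringKrullDim_quotient_eq (hO : IsUniversallyCatenaryRing O)
    (hP : P.comap (chartBase c j) = maximalIdeal O) {d : ℕ}
    (hd : ringKrullDim (chartRing c j ⧸ P) = d) :
    minimalPrimesCodim O ≤ minimalPrimesCodim O' + d := by
  obtain ⟨t, ht, hψ⟩ := exists_ltSeries_minimalPrimesCodim_le c j P O' hO hP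
  have hhead : t.head = ⟨P, inferInstance⟩ := PrimeSpectrum.ext ht
  have hlen : (t.length : ℕ∞) ≤ d := by
    rw [← coheight_eq_of_ringKrullDim_quotient_eq P hd, ← hhead]
    exact Order.length_le_coheight_head
  have hlen' : t.length ≤ d := by exact_mod_cast hlen
  omega

/-- (AL-4) **Bennett–Hironaka–Singh with the index `d = dim C/𝔴`: `H^{(i+d)}[𝒪'] ≤ H^{(i)}[𝒪]`** for all `i`, for a
permissible `𝔭 = (c_1, …, c_n)` (`𝒪/𝔭` regular, `𝒪` normally flat along `𝔭`): a chain of primes of length exactly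
`d` issues from `𝔴` (`Order.exists_series_of_coheight_eq_coe`), to which the tree's sharp inequality
`hilbertSamuelFun_add_length_le_of_isPermissible` applies. OURS helper; NOT a statement of the manuscript.
[cite: CossartJannsenSaito2020, Thm. 3.10 (1) (proof, (3.14))] [cite: HerrmannIkedaOrbanz1988, Cor. (31.2) (c)] -/
theorem hilbertSamuelFun_add_le_of_ringKrullDim_quotient_eq [(Ideal.span (Set.range c)).IsPrime]
    [IsRegularLocalRing (O ⧸ Ideal.span (Set.range c))] {s : ℕ}
    (hs : ringKrullDim (O ⧸ Ideal.span (Set.range c)) = s)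
    (hNF : (Ideal.span (Set.range c)).IsNormallyFlat) (hP : P.comap (chartBase c j) = maximalIdeal O)
    (hOO' : ∀ r : O, algebraMap O O' r =
      (algebraMap (chartRing c j) O' : chartRing c j →+* O') (chartBase c j r))
    {d : ℕ} (hd : ringKrullDim (chartRing c j ⧸ P) = d) (i : ℕ) :
    hilbertSamuelFun O' (i + d) ≤ hilbertSamuelFun O i := by
  obtain ⟨t, ht, hlen⟩ := Order.exists_series_of_coheight_eq_coe
    (⟨P, inferInstance⟩ : PrimeSpectrum (chartRing c j)) (coheight_eq_of_ringKrullDim_quotient_eq P hd)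
  have h := hilbertSamuelFun_add_length_le_of_isPermissible c j P O' hs hNF hP hOO' t (by rw [ht]) i
  rwa [hlen] at h

/-- (AL-4) **The alignment in the local rings.** On the chart of the blow-up of a universally catenary noetherian
local ring `𝒪` in a permissible `𝔭`, at `𝒪' = C_𝔴` over `𝔫`, with `d = dim C/𝔴`: if
`H^{(N ∸ ψ(𝒪'))}[𝒪'] = H^{(N ∸ ψ(𝒪))}[𝒪]` for some `N` (CJS-nearness, `Scheme.hsFun` unfolded), then
`N ∸ ψ(𝒪') = (N ∸ ψ(𝒪)) + d` and **`H^{(d+1)}[𝒪'] = H^{(1)}[𝒪]`** (the squeeze `hilbertSamuelFun_squeeze` fed with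
`minimalPrimesCodim_le_add_of_ringKrullDim_quotient_eq` and `hilbertSamuelFun_add_le_of_ringKrullDim_quotient_eq`).
OURS (equality case of CJS Thm. 3.10 (1)); NOT a statement of the manuscript.
[cite: CossartJannsenSaito2020, Thm. 3.10 (proof, (3.9), (3.14))] -/
theorem hilbertSamuelFun_succ_eq_of_sub_minimalPrimesCodim_eq (hO : IsUniversallyCatenaryRing O)
    [(Ideal.span (Set.range c)).IsPrime] [IsRegularLocalRing (O ⧸ Ideal.span (Set.range c))]
    (hNF : (Ideal.span (Set.range c)).IsNormallyFlat) (hP : P.comap (chartBase c j) = maximalIdeal O)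
    (hOO' : ∀ r : O, algebraMap O O' r =
      (algebraMap (chartRing c j) O' : chartRing c j →+* O') (chartBase c j r)) (N : ℕ)
    (hnear : hilbertSamuelFun O' (N - minimalPrimesCodim O') =
      hilbertSamuelFun O (N - minimalPrimesCodim O))
    {d : ℕ} (hd : ringKrullDim (chartRing c j ⧸ P) = d) :
    N - minimalPrimesCodim O' = N - minimalPrimesCodim O + d ∧
      hilbertSamuelFun O' (d + 1) = hilbertSamuelFun O 1 := by
  haveI : IsNoetherianRing (chartRing c j) := isNoetherianRing_chart c j
  haveI : IsNoetherianRing O' := IsLocalization.isNoetherianRing P.primeCompl O' inferInstance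
  obtain ⟨s, hs⟩ := Literature.RingTheory.HilbertSamuel.exists_ringKrullDim_quotient_eq_nat O
    (Ideal.span (Set.range c))
  have hψ := minimalPrimesCodim_le_add_of_ringKrullDim_quotient_eq c j P O' hO hP hd
  have hS := hilbertSamuelFun_add_le_of_ringKrullDim_quotient_eq c j P O' hs hNF hP hOO' hd
  exact hilbertSamuelFun_squeeze (by omega) hS hnear

omit [IsNoetherianRing O] in
/-- (AL-4) **`dim C/𝔴 = tr.deg_{κ(𝔫)} κ(𝔴) ∈ ℕ`** on the chart: `C/𝔴` is a domain of finite type over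
`k = 𝒪/𝔫` (`finiteType_chart`; `𝔴 ∩ 𝒪 = 𝔫`), so `dim C/𝔴 = tr.deg_k(C/𝔴)` (Matsumura Thm. 5.6, tree
`exists_ringKrullDim_eq_and_trdeg_eq`), and `tr.deg_k(𝒪'/𝔪') = tr.deg_k(C/𝔴)` by
`trdeg_residueField_eq_of_isLocalization_atPrime`, for ANY `k`-algebra structure on `𝒪'/𝔪'` compatible with
`𝒪 → 𝒪'` (hypothesis `hres`). The structure maps `k → C/𝔴 → 𝒪'/𝔪'` are given explicitly (typeclass search for an
algebra structure between two quotient rings would compare ideals by unfolding). OURS; NOT a statement of the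
manuscript. [cite: Matsumura1987, Thm 5.6] -/
theorem exists_ringKrullDim_quotient_eq_and_trdeg_eq (hP : P.comap (chartBase c j) = maximalIdeal O)
    (hOO' : ∀ r : O, algebraMap O O' r =
      (algebraMap (chartRing c j) O' : chartRing c j →+* O') (chartBase c j r))
    [Algebra (ResidueField O) (ResidueField O')]
    (hres : ∀ r : O, algebraMap (ResidueField O) (ResidueField O') (residue O r) =
      residue O' (algebraMap O O' r)) :
    ∃ d : ℕ, ringKrullDim (chartRing c j ⧸ P) = d ∧
      Algebra.trdeg (ResidueField O) (ResidueField O') = (d : Cardinal.{u}) := by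
  classical
  letI algOC : Algebra O (chartRing c j) := (chartBase c j).toAlgebra
  haveI : Algebra.FiniteType O (chartRing c j) := finiteType_chart c j
  -- `k = O/𝔫 → C/P`
  have hker : ∀ r : O, r ∈ maximalIdeal O → ((Ideal.Quotient.mk P).comp (chartBase c j)) r = 0 :=
    fun r hr => by
      rw [RingHom.comp_apply, Ideal.Quotient.eq_zero_iff_mem, ← Ideal.mem_comap, hP]
      exact hr
  letI algkQ : Algebra (ResidueField O) (chartRing c j ⧸ P) :=
    (Ideal.Quotient.lift (maximalIdeal O) ((Ideal.Quotient.mk P).comp (chartBase c j)) hker).toAlgebra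
  haveI : Algebra.FiniteType (ResidueField O) (chartRing c j ⧸ P) :=
    finiteType_residueField_quotient P fun r => rfl
  haveI : IsDomain (chartRing c j ⧸ P) := Ideal.Quotient.isDomain P
  obtain ⟨d, hdim, htr⟩ := Literature.RingTheory.KrullDimension.exists_ringKrullDim_eq_and_trdeg_eq
    (ResidueField O) (chartRing c j ⧸ P)
  refine ⟨d, hdim, ?_⟩
  -- `C/P → κ' = O'/𝔪'` (structure maps given explicitly: typeclass search for an `Algebra` structure
  -- between two quotient rings would try `Ideal.quotientAlgebra` and compare ideals by unfolding)
  have hPm : ∀ a : chartRing c j, a ∈ P →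
      ((residue O').comp (algebraMap (chartRing c j) O' : chartRing c j →+* O')) a = 0 :=
      fun a ha => by
    rw [RingHom.comp_apply, residue_eq_zero_iff]
    exact (IsLocalization.AtPrime.to_map_mem_maximal_iff O' P a).mpr ha
  letI algQK : Algebra (chartRing c j ⧸ P) (ResidueField O') :=
    (Ideal.Quotient.lift P
      ((residue O').comp (algebraMap (chartRing c j) O' : chartRing c j →+* O')) hPm).toAlgebra
  have hIST := @IsScalarTower.of_algebraMap_eq (ResidueField O) (chartRing c j ⧸ P) (ResidueField O')
    _ _ _ algkQ algQK _ (fun a => by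
      obtain ⟨r, rfl⟩ := IsLocalRing.residue_surjective a
      rw [hres, hOO']
      rfl)
  rw [← htr]
  exact trdeg_residueField_eq_of_isLocalization_atPrime P fun a => rfl

end Chart

/-! ## (AL) The near-point alignment on schemes -/

/-- [OURS · L1 W4.2] **(AL) THE NEAR-POINT ALIGNMENT** (object «NEAR-ALIGNMENT + DIETEL BRIDGES», res-L1-w42-plan-1
RULINGS v3.10-3 (a): the load-bearing third; replaces the role of the unstated conversion «`H_{X'}(x') = H_X(x)` ⟹
(8.2.7.A) is an equality» between CJS-near data and the hypothesis of Dietel's Thm. (8.2.7) (ii) / Main Theorem C as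
typed in F-54 / F-58 / F-58♭; NOT a statement of the manuscript [Hironaka2017]). Let `X` be locally noetherian,
`π : X' → X` a blow-up in `D` (`IsBlowup`), `x' ∈ X'` with `D` permissible at `π x'` (CJS Def. 3.1,
`IdealSheafData.IsPermissibleAt`) and `𝒪_{X,π x'}` universally catenary (e.g. `X` excellent:
`Scheme.IsExcellent.isUniversallyCatenaryRing_stalk`), and let `N` be ANY level. If `H^N_{X'}(x') = H^N_X(π x')`
(`Scheme.hsFun`; CJS Def. 2.28), then there is `d : ℕ` with
(1) `tr.deg(κ(x')/κ(π x')) = d` (`Algebra.trdeg` for `residueAlgebraOfHom π x'`),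
(2) `φ^N_{X'}(x') = φ^N_X(π x') + d` (`Scheme.hsPhi`; CJS (3.8) with equality), and
(3) `H^{(d+1)}[𝒪_{X',x'}] = H^{(1)}[𝒪_{X,π x'}]` (`hilbertSamuelFun`; Dietel (8.2.7.A) an equality, CJS (3.14) with
equality). Proof: `hilbertSamuelFun_succ_eq_of_sub_minimalPrimesCodim_eq` and
`exists_ringKrullDim_quotient_eq_and_trdeg_eq` on the Rees chart presenting `𝒪_{X',x'}`
(`IsBlowup.exists_reesChart_stalk`, as in the tree's `IsBlowup.hsFun_le_of_isPermissibleAt`); the `κ(π x')`-algebra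
structure of the proof is `residueAlgebraOfHom π x'` itself and its compatibility with `π^♯_{x'}` is definitional.
FACT-FREE; every characteristic; every point of the fibre. [cite: CossartJannsenSaito2020, Thm. 3.10 (proof, (3.7)–(3.9), (3.14))]
[cite: Dietel2015, Thm. (8.2.7) (i)–(ii) p. 105] -/
theorem exists_trdeg_hilbertSamuelFun_eq_of_hsFun_eq {X X' : Scheme.{u}} {π : X' ⟶ X}
    {D : X.IdealSheafData} [IsLocallyNoetherian X] (hπ : IsBlowup π D) (x' : X')
    (hperm : IdealSheafData.IsPermissibleAt D (π.base x'))
    (hUC : IsUniversallyCatenaryRing (X.presheaf.stalk (π.base x'))) (N : ℕ)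
    (hnear : Scheme.hsFun X' N x' = Scheme.hsFun X N (π.base x')) :
    ∃ d : ℕ,
      @Algebra.trdeg (X.residueField (π.base x')) (X'.residueField x') _ _ (residueAlgebraOfHom π x') =
          (d : Cardinal.{u}) ∧
        Scheme.hsPhi X' N x' = Scheme.hsPhi X N (π.base x') + d ∧
        hilbertSamuelFun (X'.presheaf.stalk x') (d + 1) =
          hilbertSamuelFun (X.presheaf.stalk (π.base x')) 1 := by
  classical
  obtain ⟨k, c, hc⟩ := Submodule.fg_iff_exists_fin_generating_family.mp
    (IsNoetherian.noetherian (stalkIdeal D (π.base x')))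
  obtain ⟨j, 𝔴, χ, hχ, hloc, h𝔴⟩ := hπ.exists_reesChart_stalk x' c hc
  letI algCO : Algebra (chartRing c j) (X'.presheaf.stalk x') := χ.toAlgebra
  letI algRO : Algebra (X.presheaf.stalk (π.base x')) (X'.presheaf.stalk x') :=
    (π.stalkMap x').hom.toAlgebra
  haveI : IsLocalization.AtPrime (X'.presheaf.stalk x') 𝔴.asIdeal := hloc
  have hc' : Ideal.span (Set.range c) = stalkIdeal D (π.base x') := hc
  have hp : (Ideal.span (Set.range c)).IsPermissible := by
    rw [hc']; exact hperm
  haveI : IsRegularLocalRing (X.presheaf.stalk (π.base x') ⧸ Ideal.span (Set.range c)) := hp.1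
  haveI : IsDomain (X.presheaf.stalk (π.base x') ⧸ Ideal.span (Set.range c)) :=
    isDomain_of_isRegularLocalRing _
  haveI : (Ideal.span (Set.range c)).IsPrime :=
    (Ideal.Quotient.isDomain_iff_prime _).mp inferInstance
  have hOO' : ∀ r : X.presheaf.stalk (π.base x'),
      algebraMap (X.presheaf.stalk (π.base x')) (X'.presheaf.stalk x') r =
        (algebraMap (chartRing c j) (X'.presheaf.stalk x') :
          chartRing c j →+* X'.presheaf.stalk x') (chartBase c j r) :=
    fun r => (hχ r).symm
  letI algk : Algebra (ResidueField (X.presheaf.stalk (π.base x'))) (ResidueField (X'.presheaf.stalk x')) :=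
    residueAlgebraOfHom π x'
  have hres : ∀ r : X.presheaf.stalk (π.base x'),
      algebraMap (ResidueField (X.presheaf.stalk (π.base x'))) (ResidueField (X'.presheaf.stalk x'))
        (residue _ r) = residue _ (algebraMap (X.presheaf.stalk (π.base x')) (X'.presheaf.stalk x') r) :=
    fun r => rfl
  obtain ⟨d, hd, htr⟩ := exists_ringKrullDim_quotient_eq_and_trdeg_eq c j 𝔴.asIdeal
    (X'.presheaf.stalk x') h𝔴 hOO' hres
  have hnear' : hilbertSamuelFun (X'.presheaf.stalk x') (N - minimalPrimesCodim (X'.presheaf.stalk x')) =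
      hilbertSamuelFun (X.presheaf.stalk (π.base x')) (N - minimalPrimesCodim (X.presheaf.stalk (π.base x'))) := by
    rw [Scheme.hsFun_def, Scheme.hsFun_def] at hnear
    exact hnear
  obtain ⟨hφ, hH⟩ := hilbertSamuelFun_succ_eq_of_sub_minimalPrimesCodim_eq c j 𝔴.asIdeal
    (X'.presheaf.stalk x') hUC hp.2.1 h𝔴 hOO' N hnear' hd
  exact ⟨d, htr, hφ, hH⟩

end CampaignW42

end Summit.ResolutionOfSingularities.ResolutionOfSingularities.Theorems

end
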